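import Summits.QuantumFields.YangMills.Theorems.BalabanUVNodesN08Thm2AtRecordTransplant
import Summits.QuantumFields.YangMills.Theorems.BalabanUVNodesN08Thm2AtRecordWindowCeiling

/-!
# BalabanUVNodes ∕ N08 — [Balaban1985UV3] Thm 2 at the runs of record: THE AC LANE'S THEOREM 2 AS PRINTED FOR THE DENSITIES OF THE RECORD'S BINDERS (file 4) AND OF
# THE SLOT OF RECORD (file 9) WITHOUT `εbg > 2` — the transplant of file 11 under file 8's necessary window `ε₁(0) ≤ εbg ∨ 2 < εbg`

Track A, DAG node N08 = T. Bałaban, CMP **102** (1985) 255–275 [Balaban1985UV3]: Thm 2 p. 272, (41) p. 266, (47) p. 267, (1)–(7) pp. 256–257; print's averaging (2) =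
[Balaban1985Averaging] (15) p. 19.  Cell `pub-ymgap`, width seat `pub-ymgap-dag-n08-w1` (g2), W-SEAT-START-LIST §n08 item 1 successor piece (o4), second half = file 12;
`--supports` K1⁷ `StabilityBAtRecordR13SepCoPH` (helper).  Companion of `…N08Thm2AtRecordTransplant` (file 11: the transplant `exists_transplant` of Sect.-B tower objects
to the record's binders, any `εbg`; the lane's leaf-system bridge under the window), `…N08Thm2AsPrintedAtRecordAC` (file 4) and `…AtSlotOfRecordAC` (file 9), both of
which carried `εbg > 2` (the level-0 seam of the lane's `U₀ := id`).

WHAT THIS FILE PROVES (kernel; theorems only, 0 def; nothing of the paper asserted).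
* §1 ★★ `thm2_asPrinted_at_record_binders_of_window` — **[B10] THEOREM 2 AS PRINTED ((41)_k ∧ (47)_k, every k ≤ K) FOR THE DENSITIES OF THE RECORD'S BINDERS
  `runObjects₀A N 𝔞_X 𝔗_X (Backgrounds.ofAvg N L 𝔞_X) c⋆ S` from the d = 3 lane's (α)-AC rows `AlphaAC.RunAlphaAC` at AC external inputs with the record's minimisers
  above level 0 — FOR EVERY class radius `εbg`, GIVEN ONLY THE LEVEL-0 WINDOW `ε₁(0)(S) ≤ εbg ∨ 2 < εbg`** (`k ≥ 1`: the lane's `Thm2AC.ineq41_47_of_alphaAC` transplanted by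
  file 11's `exists_transplant`; `k = 0`: file 1 §2).  No condition on the classes `reg` either.
* §2 ★★ `thm2_asPrinted_at_slotOfRecord_of_window` — the same AT THE SLOT OF RECORD's own binders `runObjects₀T N 𝔗 (Backgrounds.ofPrint N L) c⋆ S` for AC inputs at
  print's own averaging (file 9 §1's transfer), and `thm2_asPrinted_at_slotOfRecord_of_window'` along file 9 §2's A6 inhabitant (the print-averaging AC inputs EXIST).
* §3 ★★ `thm2_asPrinted_at_record_binders_of_ceiling` ∕ `…_family_of_ceiling` — FAMILY-WIDE IN PRINT'S REGIME: a coupling threshold `γ₀ ≤ e^{1−p₀}` («for g₀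
  sufficiently small») with `γ₀·p(γ₀) ≤ εbg` (file 5's print-natural side condition: [7]'s class radius dominates the (4)-window at the ceiling) gives the window, hence §1,
  at EVERY member of the lane's `≤`-family ∕ of `Family L c⋆.eps0` carrying the (α)-AC rows.
* §4 EXACTNESS (file 8): with `εbg > 0`, `N ≥ 2` the window is NECESSARY for the conclusion of §1 (`window_of_thm2_asPrinted_at_record_binders`).

HONEST FRAMING: count-neutral helper; N08 NOT discharged; the (α)-AC rows are HYPOTHESES (N08's object gap in the AC lane's currency; their data side at print's averaging
is inhabited by file 9 §2); `PrintedUV3V` NOT proved; one finite 𝕋⁴ programme at fixed ε, Bałaban AS PRINTED — R4 closes the conditional finite-𝕋⁴ rung `BalabanLadder.UV`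
only; the Yang–Mills mass gap (Clay) is NOT proved by any of this; nothing continuum ∕ ℝ⁴ ∕ OS.  No `sorry`, standard axioms.
-/

noncomputable section

namespace Summit.QuantumFields.YangMills.BalabanUVNodes.N08Thm2AtRecordTransplantAC

open Literature.MathematicalPhysics.QuantumFieldTheory.Balaban1983to89
open Literature.MathematicalPhysics.QuantumFieldTheory.Balaban1985CMP102.Theorems (Family)
open Literature.MathematicalPhysics.QuantumFieldTheory.Balaban1983to89.B10 (Ineq41 Ineq47)
open Literature.MathematicalPhysics.QuantumFieldTheory.Balaban1983to89.Node00 (SU TFamily₃)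
open Literature.MathematicalPhysics.QuantumFieldTheory.Balaban1983to89.B10RunsOfRecord
open Literature.MathematicalPhysics.QuantumFieldTheory.Balaban1985CMP102
open Literature.MathematicalPhysics.QuantumFieldTheory.Balaban1985CMP102.Setting
open Summit.QuantumFields.Balaban3D
open Summit.QuantumFields.Balaban3D.Carriers (nblkOf StepSeries)
open Summit.QuantumFields.Balaban3D.Proofs
open Summit.QuantumFields.Balaban3D.Proofs.GroupModelLieC (lieC)
open Summit.QuantumFields.Balaban3D.Proofs.Constants (eps0Of)
open Summit.QuantumFields.YangMills.BalabanUVNodes.N08Thm2AtRecordLevelZero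
open Summit.QuantumFields.YangMills.BalabanUVNodes.N08Thm2AtRecordSeamK0
open Summit.QuantumFields.YangMills.BalabanUVNodes.N08Thm2AtRecordWindowExact
open Summit.QuantumFields.YangMills.BalabanUVNodes.N08Thm2AsPrintedAtRecordAC
open Summit.QuantumFields.YangMills.BalabanUVNodes.N08Thm2AsPrintedAtSlotOfRecordAC
open Summit.QuantumFields.YangMills.BalabanUVNodes.N08Thm2AtRecordTransplant

/-! ## §1–§2 Theorem 2 as printed for the densities of the record's binders ∕ of the slot of record from the (α)-AC rows, given the window -/
section AC

variable {N : ℕ} [NeZero N] {L : ℕ} {𝔊 : GroupModel (SU N)} {𝔠 : Primitives.AlphaConsts L 𝔊.N} {εbg : ℝ}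
  {X : ∀ S : Scales L, StandardAC.ExternalInputsAC S (SU N)}
  {𝔖 : ∀ (S : Scales L) (k : ℕ), StepSeries S (SU N) ↥(lieC 𝔊) (nblkOf S 𝔠.lane.carrier k) k}
  {𝔄 : ∀ S : Scales L, AlphaAC.AlphaDataAC 𝔊 𝔠 (X S) (𝔖 S)}

/-- ★★ **[Balaban1985UV3] THEOREM 2 AS PRINTED FOR THE DENSITIES OF THE RECORD'S BINDERS from the d = 3 lane's (α)-AC rows — ANY class radius `εbg`, GIVEN THE LEVEL-0
WINDOW** at the constants `c⋆ = (eps0Of γ₀, Σ_{j<K}E^{(j)}, lane b₀, p₀, εbg)` and the lattice approximation `S` (one member of the `≤`-family): AC external inputs with the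
record's minimisers above level 0 ⇒ tower objects `W` EXTENDING `runObjects₀A N 𝔞_X 𝔗_X (Backgrounds.ofAvg N L 𝔞_X) c⋆ S` with (41)_k ∧ (47)_k for every `k ≤ K`
(file 4's `thm2_asPrinted_at_record_binders` had `εbg > 2`; here `k ≥ 1` is the lane's `Thm2AC.ineq41_47_of_alphaAC` transplanted, `k = 0` is file 1 §2).
[cite: Balaban1985UV3, Thm 2 p.272 + (41) p.266 + (47) p.267 + (4), (7) pp.256–257] -/
theorem thm2_asPrinted_at_record_binders_of_window
    (hUk : ∀ (S : Scales L) k (V : GaugeField S.P (k + 1) (SU N)), (X S).Uk k V = UkA N (fun S => (X S).av) S (k + 1) εbg V)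
    {S : Scales L} (hle : S.g ^ 2 * S.ε₀ ≤ (min 𝔠.gamma0 1) ^ 2) (R : AlphaAC.RunAlphaAC 𝔊 𝔠 (X S) (𝔖 S) (𝔄 S))
    (hwin : eps1OfPrint
        { eps0 := eps0Of 𝔠.gamma0, E := fun S => B10.Ek (InputsAC.inputOfAC 𝔠.lane (X S) (𝔖 S)).Estep S.K 0,
          b₀ := 𝔠.lane.F.b₀, p₀ := 𝔠.lane.F.p₀, εbg := εbg } S 0 ≤ εbg ∨ 2 < εbg) :
    ∃ W : SectB.TowerObjects S (SU N),
      W.toRunObjects = runObjects₀A N (fun S => (X S).av)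
        (fun S j => (Carriers.run3 ((InputsAC.inputOfAC 𝔠.lane (X S) (𝔖 S)).toRunInput fun _ => True)).T j)
        (Backgrounds.ofAvg N L fun S => (X S).av)
        { eps0 := eps0Of 𝔠.gamma0, E := fun S => B10.Ek (InputsAC.inputOfAC 𝔠.lane (X S) (𝔖 S)).Estep S.K 0,
          b₀ := 𝔠.lane.F.b₀, p₀ := 𝔠.lane.F.p₀, εbg := εbg } S ∧
      ∀ k, k ≤ S.K → Ineq41 W.pin.toTowerRun k ∧ Ineq47 W.pin.toTowerRun k := by
  obtain ⟨W', hW', hiff, hP0, hLF, -⟩ := exists_transplant ((InputsAC.inputOfAC 𝔠.lane (X S) (𝔖 S)).towerWith fun _ => True)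
    (runObjects₀A N (fun S => (X S).av)
        (fun S j => (Carriers.run3 ((InputsAC.inputOfAC 𝔠.lane (X S) (𝔖 S)).toRunInput fun _ => True)).T j)
        (Backgrounds.ofAvg N L fun S => (X S).av)
        { eps0 := eps0Of 𝔠.gamma0, E := fun S => B10.Ek (InputsAC.inputOfAC 𝔠.lane (X S) (𝔖 S)).Estep S.K 0,
          b₀ := 𝔠.lane.F.b₀, p₀ := 𝔠.lane.F.p₀, εbg := εbg } S)
    (fun k V => (hUk S k V).symm) rfl (fun _ => rfl)
    (fun k U => congrFun (rho_congr
      (runObjects₀A N (fun S => (X S).av)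
        (fun S j => (Carriers.run3 ((InputsAC.inputOfAC 𝔠.lane (X S) (𝔖 S)).toRunInput fun _ => True)).T j)
        (Backgrounds.ofAvg N L fun S => (X S).av)
        { eps0 := eps0Of 𝔠.gamma0, E := fun S => B10.Ek (InputsAC.inputOfAC 𝔠.lane (X S) (𝔖 S)).Estep S.K 0,
          b₀ := 𝔠.lane.F.b₀, p₀ := 𝔠.lane.F.p₀, εbg := εbg } S)
      ((InputsAC.inputOfAC 𝔠.lane (X S) (𝔖 S)).towerWith fun _ => True).toRunObjects rfl HEq.rfl rfl k) U)
    (fun V F => TowerAC.TowerInputAC.towerWith_lf_zero _ _ V F)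
  have hP0' : ∀ (h : W'.Hist 0) (V : GaugeField S.P 0 (SU N)), W'.Pint 0 h V = 0 := hP0 fun _ _ => rfl
  refine ⟨W', hW', fun k hk => ?_⟩
  rcases Nat.eq_zero_or_pos k with rfl | hpos
  · exact ⟨ineq41_zero hW' hP0' fun V F => (hLF V F).symm.le,
      ineq47_zero_of_window hW' hP0' fun V hV => hwin.elim
        (fun h => (plaqSmall_eta_zero_iff N S εbg V).2 (plaqSmall_mono h hV)) (fun h => plaqSmall_level_zero_of_two_lt N S h V)⟩
  · have h := Thm2AC.ineq41_47_of_alphaAC hle R k hk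
    exact ⟨((hiff k hpos).1).2 h.1, ((hiff k hpos).2).2 h.2⟩

/-- ★★ **… AT THE SLOT OF RECORD** (AC inputs at print's own averaging, `(X S).av = avOfPrint N S`): a version `𝔗` of (2) along print's averaging and tower objects
EXTENDING `runObjects₀T N 𝔗 (Backgrounds.ofPrint N L) c⋆ S` with (41)_k ∧ (47)_k for every `k ≤ K` — file 9's `thm2_asPrinted_at_slotOfRecord` WITHOUT `εbg > 2`, under
the window. [cite: Balaban1985UV3, Thm 2 p.272 + (41) p.266 + (47) p.267; Balaban1985Averaging, (15) p.19] -/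
theorem thm2_asPrinted_at_slotOfRecord_of_window (hav : ∀ S, (X S).av = avOfPrint N S)
    (hUk : ∀ (S : Scales L) k (V : GaugeField S.P (k + 1) (SU N)), (X S).Uk k V = UkA N (fun S => (X S).av) S (k + 1) εbg V)
    {S : Scales L} (hle : S.g ^ 2 * S.ε₀ ≤ (min 𝔠.gamma0 1) ^ 2) (R : AlphaAC.RunAlphaAC 𝔊 𝔠 (X S) (𝔖 S) (𝔄 S))
    (hwin : eps1OfPrint
        { eps0 := eps0Of 𝔠.gamma0, E := fun S => B10.Ek (InputsAC.inputOfAC 𝔠.lane (X S) (𝔖 S)).Estep S.K 0,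
          b₀ := 𝔠.lane.F.b₀, p₀ := 𝔠.lane.F.p₀, εbg := εbg } S 0 ≤ εbg ∨ 2 < εbg) :
    ∃ (𝔗 : TFamily₃ N L) (W : SectB.TowerObjects S (SU N)),
      W.toRunObjects = runObjects₀T N 𝔗 (Backgrounds.ofPrint N L)
        { eps0 := eps0Of 𝔠.gamma0, E := fun S => B10.Ek (InputsAC.inputOfAC 𝔠.lane (X S) (𝔖 S)).Estep S.K 0,
          b₀ := 𝔠.lane.F.b₀, p₀ := 𝔠.lane.F.p₀, εbg := εbg } S ∧
      ∀ k, k ≤ S.K → Ineq41 W.pin.toTowerRun k ∧ Ineq47 W.pin.toTowerRun k := by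
  obtain ⟨W, hW, h⟩ := thm2_asPrinted_at_record_binders_of_window (𝔄 := 𝔄) hUk hle R hwin
  obtain ⟨𝔗', h'⟩ := exists_TFamily₃_of_av_eq' (funext hav) _ hW
  exact ⟨𝔗', W, h', h⟩

/-- **… along file 9 §2's A6 inhabitant**: the print-averaging AC inputs pinned to the record EXIST, so the hypotheses of §2 reduce to the lane's step series `𝔖`, the
(α)-AC data `𝔄` with its rows `RunAlphaAC`, one member of the `≤`-family, and the window. [cite: Balaban1985UV3, Thm 2 p.272; Balaban1985Averaging, (15) p.19] -/
theorem thm2_asPrinted_at_slotOfRecord_of_window' (N : ℕ) [NeZero N] (L : ℕ) (𝔊 : GroupModel (SU N)) (𝔠 : Primitives.AlphaConsts L 𝔊.N) (εbg : ℝ) :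
    ∃ X : ∀ S : Scales L, StandardAC.ExternalInputsAC S (SU N), (∀ S, (X S).av = avOfPrint N S) ∧
      ∀ (𝔖 : ∀ (S : Scales L) (k : ℕ), StepSeries S (SU N) ↥(lieC 𝔊) (nblkOf S 𝔠.lane.carrier k) k)
        (𝔄 : ∀ S : Scales L, AlphaAC.AlphaDataAC 𝔊 𝔠 (X S) (𝔖 S)) (S : Scales L),
        S.g ^ 2 * S.ε₀ ≤ (min 𝔠.gamma0 1) ^ 2 → AlphaAC.RunAlphaAC 𝔊 𝔠 (X S) (𝔖 S) (𝔄 S) →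
        (eps1OfPrint
          { eps0 := eps0Of 𝔠.gamma0, E := fun S => B10.Ek (InputsAC.inputOfAC 𝔠.lane (X S) (𝔖 S)).Estep S.K 0,
            b₀ := 𝔠.lane.F.b₀, p₀ := 𝔠.lane.F.p₀, εbg := εbg } S 0 ≤ εbg ∨ 2 < εbg) →
        ∃ (𝔗 : TFamily₃ N L) (W : SectB.TowerObjects S (SU N)),
          W.toRunObjects = runObjects₀T N 𝔗 (Backgrounds.ofPrint N L)
            { eps0 := eps0Of 𝔠.gamma0, E := fun S => B10.Ek (InputsAC.inputOfAC 𝔠.lane (X S) (𝔖 S)).Estep S.K 0,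
              b₀ := 𝔠.lane.F.b₀, p₀ := 𝔠.lane.F.p₀, εbg := εbg } S ∧
          ∀ k, k ≤ S.K → Ineq41 W.pin.toTowerRun k ∧ Ineq47 W.pin.toTowerRun k := by
  obtain ⟨X, hav, -, hUk⟩ := exists_externalInputsAC_ofPrint N L εbg
  exact ⟨X, hav, fun 𝔖 𝔄 S hle R hwin => thm2_asPrinted_at_slotOfRecord_of_window (𝔄 := 𝔄) hav hUk hle R hwin⟩

end AC

/-! ## §3 Family-wide in print's regime: a coupling ceiling below `e^{1−p₀}` with the (4)-window at the ceiling inside [7]'s class -/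
section Ceiling

variable {N : ℕ} [NeZero N] {L : ℕ} {𝔊 : GroupModel (SU N)} {𝔠 : Primitives.AlphaConsts L 𝔊.N} {εbg : ℝ}
  {X : ∀ S : Scales L, StandardAC.ExternalInputsAC S (SU N)}
  {𝔖 : ∀ (S : Scales L) (k : ℕ), StepSeries S (SU N) ↥(lieC 𝔊) (nblkOf S 𝔠.lane.carrier k) k}
  {𝔄 : ∀ S : Scales L, AlphaAC.AlphaDataAC 𝔊 𝔠 (X S) (𝔖 S)}

/-- ★★ **THEOREM 2 AS PRINTED FOR THE DENSITIES OF THE RECORD'S BINDERS, AT EVERY MEMBER OF THE LANE'S `≤`-FAMILY, IN PRINT'S REGIME**: if the lane's coupling threshold is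
below `e^{1−p₀}` («for g₀ sufficiently small», p. 259 L1) and [7]'s class radius dominates the (4)-window at that ceiling, `γ₀·p(γ₀) ≤ εbg` (file 5's print-natural side
condition), then at EVERY lattice approximation of the `≤`-family `g²ε₀ ≤ (min γ₀ 1)²` carrying the (α)-AC rows there are tower objects extending the record's binders at
`c⋆` with (41)_k ∧ (47)_k for all `k ≤ K` (file 5's `eps1OfPrint_zero_le_of_ceiling` + `FamilyLE.gk_le_gamma0_of_le` give the window; §1). [cite: Balaban1985UV3, Thm 2 p.272 + (7) p.257 + p.259 L1] -/
theorem thm2_asPrinted_at_record_binders_of_ceiling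
    (hUk : ∀ (S : Scales L) k (V : GaugeField S.P (k + 1) (SU N)), (X S).Uk k V = UkA N (fun S => (X S).av) S (k + 1) εbg V)
    (hγ : 𝔠.gamma0 ≤ Real.exp (1 - 𝔠.lane.F.p₀)) (hε : 𝔠.gamma0 * B10.pFun 𝔠.lane.F.b₀ 𝔠.lane.F.p₀ 𝔠.gamma0 ≤ εbg)
    {S : Scales L} (hle : S.g ^ 2 * S.ε₀ ≤ (min 𝔠.gamma0 1) ^ 2) (R : AlphaAC.RunAlphaAC 𝔊 𝔠 (X S) (𝔖 S) (𝔄 S)) :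
    ∃ W : SectB.TowerObjects S (SU N),
      W.toRunObjects = runObjects₀A N (fun S => (X S).av)
        (fun S j => (Carriers.run3 ((InputsAC.inputOfAC 𝔠.lane (X S) (𝔖 S)).toRunInput fun _ => True)).T j)
        (Backgrounds.ofAvg N L fun S => (X S).av)
        { eps0 := eps0Of 𝔠.gamma0, E := fun S => B10.Ek (InputsAC.inputOfAC 𝔠.lane (X S) (𝔖 S)).Estep S.K 0,
          b₀ := 𝔠.lane.F.b₀, p₀ := 𝔠.lane.F.p₀, εbg := εbg } S ∧
      ∀ k, k ≤ S.K → Ineq41 W.pin.toTowerRun k ∧ Ineq47 W.pin.toTowerRun k :=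
  thm2_asPrinted_at_record_binders_of_window (𝔄 := 𝔄) hUk hle R (Or.inl
    ((N08Thm2AtRecordWindowCeiling.eps1OfPrint_zero_le_of_ceiling
        ({ eps0 := eps0Of 𝔠.gamma0, E := fun S => B10.Ek (InputsAC.inputOfAC 𝔠.lane (X S) (𝔖 S)).Estep S.K 0,
           b₀ := 𝔠.lane.F.b₀, p₀ := 𝔠.lane.F.p₀, εbg := εbg } : Consts L)
        𝔠.lane.F.b₀_pos.le (by linarith [𝔠.lane.F.two_lt_p₀]) S
        (FamilyLE.gk_le_gamma0_of_le S 𝔠.gamma0_pos.le hle 0 (Nat.zero_le _)) hγ).trans hε))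

/-- **… hence on the record's family `Family L c⋆.eps0`** (`c⋆.eps0 = eps0Of γ₀`: every member lies on the `≤`-family, `FamilyLE.le_of_eps0Of`): under the print-regime
conditions and the (α)-AC rows at every member, EVERY member carries tower objects extending the record's binders with (41)∕(47) for all `k ≤ K`.
[cite: Balaban1985UV3, Thm 2 p.272 + p.256 L15–18] -/
theorem thm2_asPrinted_at_record_binders_family_of_ceiling
    (hUk : ∀ (S : Scales L) k (V : GaugeField S.P (k + 1) (SU N)), (X S).Uk k V = UkA N (fun S => (X S).av) S (k + 1) εbg V)
    (hγ : 𝔠.gamma0 ≤ Real.exp (1 - 𝔠.lane.F.p₀)) (hε : 𝔠.gamma0 * B10.pFun 𝔠.lane.F.b₀ 𝔠.lane.F.p₀ 𝔠.gamma0 ≤ εbg)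
    (R : ∀ S : Family L (eps0Of 𝔠.gamma0), AlphaAC.RunAlphaAC 𝔊 𝔠 (X S.1) (𝔖 S.1) (𝔄 S.1)) (S : Family L (eps0Of 𝔠.gamma0)) :
    ∃ W : SectB.TowerObjects S.1 (SU N),
      W.toRunObjects = runObjects₀A N (fun S => (X S).av)
        (fun S j => (Carriers.run3 ((InputsAC.inputOfAC 𝔠.lane (X S) (𝔖 S)).toRunInput fun _ => True)).T j)
        (Backgrounds.ofAvg N L fun S => (X S).av)
        { eps0 := eps0Of 𝔠.gamma0, E := fun S => B10.Ek (InputsAC.inputOfAC 𝔠.lane (X S) (𝔖 S)).Estep S.K 0,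
          b₀ := 𝔠.lane.F.b₀, p₀ := 𝔠.lane.F.p₀, εbg := εbg } S.1 ∧
      ∀ k, k ≤ S.1.K → Ineq41 W.pin.toTowerRun k ∧ Ineq47 W.pin.toTowerRun k :=
  thm2_asPrinted_at_record_binders_of_ceiling (𝔄 := 𝔄) hUk hγ hε (FamilyLE.le_of_eps0Of S.1 S.2) (R S)

end Ceiling

/-! ## §4 Exactness for the AC constants -/
section Exact

variable {N : ℕ} [NeZero N] {L : ℕ} {𝔊 : GroupModel (SU N)} {𝔠 : Primitives.AlphaConsts L 𝔊.N} {εbg : ℝ}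
  {X : ∀ S : Scales L, StandardAC.ExternalInputsAC S (SU N)}
  {𝔖 : ∀ (S : Scales L) (k : ℕ), StepSeries S (SU N) ↥(lieC 𝔊) (nblkOf S 𝔠.lane.carrier k) k}

/-- **The window is NECESSARY for §1's conclusion** (`SU(N)`, `N ≥ 2`, `εbg > 0`): tower objects extending the record's binders at `c⋆` with print's k = 0 interaction data
and (47)₀ force `ε₁(0)(S) ≤ εbg ∨ 2 < εbg` (file 8). [cite: Balaban1985UV3, (47) p.267 + (4), (7) pp.256–257] -/
theorem window_of_thm2_asPrinted_at_record_binders (hN : 2 ≤ N) (hε : 0 < εbg) {S : Scales L}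
    (h : ∃ W : SectB.TowerObjects S (SU N),
      W.toRunObjects = runObjects₀A N (fun S => (X S).av)
        (fun S j => (Carriers.run3 ((InputsAC.inputOfAC 𝔠.lane (X S) (𝔖 S)).toRunInput fun _ => True)).T j)
        (Backgrounds.ofAvg N L fun S => (X S).av)
        { eps0 := eps0Of 𝔠.gamma0, E := fun S => B10.Ek (InputsAC.inputOfAC 𝔠.lane (X S) (𝔖 S)).Estep S.K 0,
          b₀ := 𝔠.lane.F.b₀, p₀ := 𝔠.lane.F.p₀, εbg := εbg } S ∧
      (∀ (h : W.Hist 0) (V : GaugeField S.P 0 (SU N)), W.Pint 0 h V = 0) ∧ Ineq47 W.pin.toTowerRun 0) :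
    eps1OfPrint
        { eps0 := eps0Of 𝔠.gamma0, E := fun S => B10.Ek (InputsAC.inputOfAC 𝔠.lane (X S) (𝔖 S)).Estep S.K 0,
          b₀ := 𝔠.lane.F.b₀, p₀ := 𝔠.lane.F.p₀, εbg := εbg } S 0 ≤ εbg ∨ 2 < εbg := by
  obtain ⟨W, hW, hP0, h47⟩ := h
  exact (ineq47_zero_iff_consts hN hW hP0 hε).1 h47

end Exact

/-! ## §5 (v1.1, APPEND-ONLY) Family-wide WITHOUT the regime condition on `γ₀`: the window from the constants alone

v1.1 (same seat, 2026-08-28).  §1–§4 are byte-identical.  §3's binder `hγ : 𝔠.gamma0 ≤ e^{1−p₀}` constrains the lane's DEFINED threshold `γ₀` (plausible, unproved);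
file 1 §3's crude bound `ε₁(0) ≤ b₀p₀^{p₀}e^{1−p₀}` (every coupling `g₀ ≤ 1`, `…LevelZero.eps1OfPrint_zero_le`) needs only `b₀p₀^{p₀}e^{1−p₀} ≤ εbg` on the FREE class radius. -/
section FromConsts

variable {N : ℕ} [NeZero N] {L : ℕ} {𝔊 : GroupModel (SU N)} {𝔠 : Primitives.AlphaConsts L 𝔊.N} {εbg : ℝ}
  {X : ∀ S : Scales L, StandardAC.ExternalInputsAC S (SU N)}
  {𝔖 : ∀ (S : Scales L) (k : ℕ), StepSeries S (SU N) ↥(lieC 𝔊) (nblkOf S 𝔠.lane.carrier k) k}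
  {𝔄 : ∀ S : Scales L, AlphaAC.AlphaDataAC 𝔊 𝔠 (X S) (𝔖 S)}

/-- ★★ **THEOREM 2 AS PRINTED FOR THE DENSITIES OF THE RECORD'S BINDERS AT EVERY MEMBER OF THE `≤`-FAMILY, `b₀p₀^{p₀}e^{1−p₀} ≤ εbg`** (no condition on `γ₀`): the
window from file 1 §3's crude bound, then §1. [cite: Balaban1985UV3, Thm 2 p.272 + (7) p.257] -/
theorem thm2_asPrinted_at_record_binders_of_consts
    (hUk : ∀ (S : Scales L) k (V : GaugeField S.P (k + 1) (SU N)), (X S).Uk k V = UkA N (fun S => (X S).av) S (k + 1) εbg V)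
    (hε : 𝔠.lane.F.b₀ * (𝔠.lane.F.p₀ ^ 𝔠.lane.F.p₀ * Real.exp (1 - 𝔠.lane.F.p₀)) ≤ εbg)
    {S : Scales L} (hle : S.g ^ 2 * S.ε₀ ≤ (min 𝔠.gamma0 1) ^ 2) (R : AlphaAC.RunAlphaAC 𝔊 𝔠 (X S) (𝔖 S) (𝔄 S)) :
    ∃ W : SectB.TowerObjects S (SU N),
      W.toRunObjects = runObjects₀A N (fun S => (X S).av)
        (fun S j => (Carriers.run3 ((InputsAC.inputOfAC 𝔠.lane (X S) (𝔖 S)).toRunInput fun _ => True)).T j)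
        (Backgrounds.ofAvg N L fun S => (X S).av)
        { eps0 := eps0Of 𝔠.gamma0, E := fun S => B10.Ek (InputsAC.inputOfAC 𝔠.lane (X S) (𝔖 S)).Estep S.K 0,
          b₀ := 𝔠.lane.F.b₀, p₀ := 𝔠.lane.F.p₀, εbg := εbg } S ∧
      ∀ k, k ≤ S.K → Ineq41 W.pin.toTowerRun k ∧ Ineq47 W.pin.toTowerRun k :=
  thm2_asPrinted_at_record_binders_of_window (𝔄 := 𝔄) hUk hle R (Or.inl
    ((eps1OfPrint_zero_le
        ({ eps0 := eps0Of 𝔠.gamma0, E := fun S => B10.Ek (InputsAC.inputOfAC 𝔠.lane (X S) (𝔖 S)).Estep S.K 0,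
           b₀ := 𝔠.lane.F.b₀, p₀ := 𝔠.lane.F.p₀, εbg := εbg } : Consts L)
        𝔠.lane.F.b₀_pos.le (by linarith [𝔠.lane.F.two_lt_p₀]) S).trans hε))

/-- **… hence on the record's family `Family L c⋆.eps0`** (every member lies on the `≤`-family), `b₀p₀^{p₀}e^{1−p₀} ≤ εbg`. [cite: Balaban1985UV3, Thm 2 p.272 + p.256 L15–18] -/
theorem thm2_asPrinted_at_record_binders_family_of_consts
    (hUk : ∀ (S : Scales L) k (V : GaugeField S.P (k + 1) (SU N)), (X S).Uk k V = UkA N (fun S => (X S).av) S (k + 1) εbg V)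
    (hε : 𝔠.lane.F.b₀ * (𝔠.lane.F.p₀ ^ 𝔠.lane.F.p₀ * Real.exp (1 - 𝔠.lane.F.p₀)) ≤ εbg)
    (R : ∀ S : Family L (eps0Of 𝔠.gamma0), AlphaAC.RunAlphaAC 𝔊 𝔠 (X S.1) (𝔖 S.1) (𝔄 S.1)) (S : Family L (eps0Of 𝔠.gamma0)) :
    ∃ W : SectB.TowerObjects S.1 (SU N),
      W.toRunObjects = runObjects₀A N (fun S => (X S).av)
        (fun S j => (Carriers.run3 ((InputsAC.inputOfAC 𝔠.lane (X S) (𝔖 S)).toRunInput fun _ => True)).T j)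
        (Backgrounds.ofAvg N L fun S => (X S).av)
        { eps0 := eps0Of 𝔠.gamma0, E := fun S => B10.Ek (InputsAC.inputOfAC 𝔠.lane (X S) (𝔖 S)).Estep S.K 0,
          b₀ := 𝔠.lane.F.b₀, p₀ := 𝔠.lane.F.p₀, εbg := εbg } S.1 ∧
      ∀ k, k ≤ S.1.K → Ineq41 W.pin.toTowerRun k ∧ Ineq47 W.pin.toTowerRun k :=
  thm2_asPrinted_at_record_binders_of_consts (𝔄 := 𝔄) hUk hε (FamilyLE.le_of_eps0Of S.1 S.2) (R S)

end FromConsts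

end Summit.QuantumFields.YangMills.BalabanUVNodes.N08Thm2AtRecordTransplantAC

end
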